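import Summits.KontsevichZagierPeriods.KontsevichZagierPeriods.Theorems.SoloInformedScissorsIdeal
import Summits.KontsevichZagierPeriods.KontsevichZagierPeriods.Theorems.SoloInformedNLSummitForms
import HarnessLib
import HarnessLib.Audit

/-!
# SoloInformed — regions under graphs and density removal (COROLLARY NF.2, file B = tree file `SoloInformedUnderGraph`)

Solo programme `solo-KontsevichZagierPeriods-informed`, session s247 (K-NF.2, file B).

**The subgraph homomorphism.**  To every integral representation `r = [σ, f]` of dimension `n` attach
the two volume representations of dimension `n + 1`
`U(r) = [{(x,t) | x ∈ σ, 0 ≤ t ≤ f x}, 1]` and `U(r⁻) = [{(x,t) | x ∈ σ, 0 ≤ t ≤ −f x}, 1]`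
(`soloInformedUnder r`, `soloInformedUnder r.neg`: the regions under the graphs of `f₊` and `f₋`, up
to null sets), and extend `[r] ↦ [U(r)] − [U(r⁻)]` additively to
`sub = soloInformedSub : FormalRep →+ FormalRep`.  For a volume representation `A`,
`sub [A] ≡ Fl [A] = [A × [0,1]]` modulo the scissors group `𝒮` (`soloInformed_sub_sub_flatMap_mem`).

**Density removal** (`SoloInformedDensityRemoval`) is the statement that `sub` carries the
equidimensional KZ relations into scissors relations: `x ∈ relations₁₂ → sub x ∈ 𝒮` — an
equidimensional chain of moves (1a), (1b), (2) between two volume representations, whose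
intermediate representations carry arbitrary semialgebraic densities, can be traded for a chain of
scissors moves and volume-preserving maps between the regions under the graphs, one dimension up.

**Proved here (unconditional).**
* `soloInformed_stableH3_of_densityRemoval` — density removal `→ (KontsevichZagierPeriods →
  SoloInformedStableH3)`, hence (`soloInformed_summit_iff_stableH3_of_densityRemoval`) density removal
  `→ (KontsevichZagierPeriods ↔ SoloInformedStableH3)`: with THEOREM NF
  (`soloInformed_equivalent_iff_exists_flatIter`: KZ-equivalent representations of one dimension are
  `relations₁₂`-congruent after `k` flattenings) and `sub ∘ Fl^k ≡ Fl^(k+1)` on volume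
  representations;
* `soloInformed_sub_mem_scissorsRel_of_mem_domainAddRel` — **density removal for the moves (1a)**:
  `U` of a domain-additivity move is a scissors move (`σ = σ₁ ∪ σ₂` with null overlap cuts the region
  under the graph along the null cylinder over `σ₁ ∩ σ₂`).

The moves (2) (one volume-preserving map `(x,t) ↦ (Φ x, t / |det Φ'(x)|)` off the critical and
singular loci) and (1b) (stacking of subgraphs by the shears `(x,t) ↦ (x, t + f₁ x)` on the sign
cells) are the next files; with them `SoloInformedDensityRemoval` and COROLLARY NF.2
`KontsevichZagierPeriods ↔ SoloInformedStableH3` become unconditional.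

References: M. Kontsevich, D. Zagier, *Periods* (2001), §1.2; J. Viu-Sos, IJNT 17 (2021), Cor. 2.3
(regions under graphs); J. Cresson, J. Viu-Sos, JTNB 34 (2022), §§3–5; this work,
`paper/nl-elimination.md` COROLLARY NF.2.
-/

noncomputable section

open scoped BigOperators

namespace Summit.KontsevichZagierPeriods.KontsevichZagierPeriods.Theorems

open Set MeasureTheory
open Literature.ModelTheory.ExponentialFields
open Literature.NumberTheory.Transcendental Literature.NumberTheory.Transcendental.KZ

variable {n m k d : ℕ}

/-! ### The region under the graph -/

/-- The region `{(x,t) | x ∈ σ, 0 ≤ t ≤ f x}` under the graph of the integrand is `ℚ`-semialgebraic.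
[BCR 1998, §2.2] -/
theorem soloInformed_isSemialgebraic_underBand (r : IntegralRep n) :
    IsSemialgebraic ℚ (KZlog.band r.domain (fun _ => 0) r.integrand) :=
  KZlog.isSemialgebraic_band (by simpa using isSemialgebraicFunOn_ratCast r.isSemialgebraic_domain 0)
    r.isSemialgebraicFunOn_integrand

/-- The region under the graph of an absolutely integrable integrand has finite volume (Tonelli: its
fibre over `x` has length `max (f x) 0 ≤ |f x|`). [folklore] -/
theorem soloInformed_integrableOn_one_underBand (r : IntegralRep n) :
    IntegrableOn (fun _ => (1 : ℝ)) (KZlog.band r.domain (fun _ => 0) r.integrand) := by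
  refine KZlog.integrableOn_band_of_lintegral_fibre_le (IntegralRep.measurableSet_domain_holds r)
    (IsSemialgebraic.measurableSet_holds (soloInformed_isSemialgebraic_underBand r))
    (fun x t => KZlog.snoc_mem_band) aestronglyMeasurable_const (K := r.integrand)
    (fun x _ => ?_) r.integrableOn
  rw [setLIntegral_const, Real.volume_Icc, sub_zero, enorm_one, one_mul, Real.enorm_eq_ofReal_abs]
  exact ENNReal.ofReal_le_ofReal (le_abs_self _)

/-- **The region under the graph** `U(r) = [{(x,t) | x ∈ σ, 0 ≤ t ≤ f x}, 1]` of `r = [σ, f]`, a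
volume representation of dimension `n + 1` (empty fibres where `f < 0`).
[Viu-Sos 2021, Cor. 2.3; Kontsevich–Zagier 2001, §1.1] -/
def soloInformedUnder (r : IntegralRep n) : IntegralRep (n + 1) where
  domain := KZlog.band r.domain (fun _ => 0) r.integrand
  integrand := fun _ => 1
  isSemialgebraic_domain := soloInformed_isSemialgebraic_underBand r
  isSemialgebraicFunOn_integrand := by
    simpa using isSemialgebraicFunOn_ratCast (soloInformed_isSemialgebraic_underBand r) 1
  integrableOn := soloInformed_integrableOn_one_underBand r

/-- Membership in the region under the graph. -/
theorem soloInformed_mem_under_domain (r : IntegralRep n) (z : Fin (n + 1) → ℝ) :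
    z ∈ (soloInformedUnder r).domain ↔
      Fin.init z ∈ r.domain ∧ 0 ≤ z (Fin.last n) ∧ z (Fin.last n) ≤ r.integrand (Fin.init z) :=
  Iff.rfl

/-- The integrand of `U(r)` is `1`. -/
@[simp] theorem soloInformed_under_integrand (r : IntegralRep n) (z : Fin (n + 1) → ℝ) :
    (soloInformedUnder r).integrand z = 1 := rfl

/-- `U(r)` is a volume representation. -/
theorem soloInformed_isVolRep_under (r : IntegralRep n) : SoloInformedIsVolRep (soloInformedUnder r) :=
  fun _ _ => rfl

/-- **The subgraph homomorphism** `sub : FormalRep →+ FormalRep`, `[r] ↦ [U(r)] − [U(r⁻)]`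
(regions under the graphs of the positive and negative parts of the integrand). [this work] -/
def soloInformedSub : FormalRep →+ FormalRep :=
  FreeAbelianGroup.lift fun x : (Σ n, IntegralRep n) =>
    of (soloInformedUnder x.2) - of (soloInformedUnder x.2.neg)

/-- `sub [r] = [U(r)] − [U(r⁻)]`. [this work] -/
theorem soloInformed_sub_of (r : IntegralRep n) :
    soloInformedSub (of r) = of (soloInformedUnder r) - of (soloInformedUnder r.neg) :=
  FreeAbelianGroup.lift_apply_of _ _

/-! ### `sub` of a volume representation is its flattening, in `K(ℚ)` -/

/-- For a volume representation `A = [σ, 1]`, the region under the graph is `σ × [0,1]` as a set. -/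
theorem soloInformed_under_domain_eq_flat_domain {A : IntegralRep n} (hA : SoloInformedIsVolRep A) :
    (soloInformedUnder A).domain = (soloInformedFlat A).domain := by
  ext z
  rw [soloInformed_mem_under_domain, soloInformed_flat_domain, mem_setOf_eq]
  constructor
  · rintro ⟨h1, h2, h3⟩
    exact ⟨h1, h2, by rwa [hA _ h1] at h3⟩
  · rintro ⟨h1, h2, h3⟩
    exact ⟨h1, h2, by rwa [hA _ h1]⟩

/-- For a volume representation `A`, the region under the graph of `−1` is empty. -/
theorem soloInformed_under_neg_domain_eq_empty {A : IntegralRep n} (hA : SoloInformedIsVolRep A) :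
    (soloInformedUnder A.neg).domain = ∅ := by
  ext z
  rw [soloInformed_mem_under_domain, IntegralRep.domain_neg, IntegralRep.integrand_neg]
  simp only [Pi.neg_apply, mem_empty_iff_false, iff_false, not_and]
  intro h1 h2 h3
  rw [hA _ h1] at h3
  linarith

/-- **`sub [A] ≡ Fl [A]` modulo `𝒮`** for a volume representation `A`: `[U(A)] − [A × [0,1]]` is a
volume-preserving map (same domain) and `[U(A⁻)] = [∅]` vanishes. [this work] -/
theorem soloInformed_sub_sub_flatMap_mem {A : IntegralRep n} (hA : SoloInformedIsVolRep A) :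
    soloInformedSub (of A) - soloInformedFlatMap (of A) ∈ soloInformedScissorsRel := by
  rw [soloInformed_sub_of, soloInformed_flatMap_of]
  have h1 : of (soloInformedUnder A) - of (soloInformedFlat A) ∈ soloInformedScissorsRel :=
    soloInformed_of_sub_of_mem_scissorsRel_of_domain_eq (soloInformed_isVolRep_under A)
      (soloInformed_isVolRep_flat hA) (soloInformed_under_domain_eq_flat_domain hA)
  have h2 : of (soloInformedUnder A.neg) ∈ soloInformedScissorsRel :=
    soloInformed_of_mem_scissorsRel_of_domain_eq_empty (soloInformed_isVolRep_under A.neg)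
      (soloInformed_under_neg_domain_eq_empty hA)
  have : of (soloInformedUnder A) - of (soloInformedUnder A.neg) - of (soloInformedFlat A) =
      (of (soloInformedUnder A) - of (soloInformedFlat A)) - of (soloInformedUnder A.neg) := by abel
  rw [this]
  exact soloInformedScissorsRel.sub_mem h1 h2

/-! ### Density removal and COROLLARY NF.2 -/

/-- **DENSITY REMOVAL**: the subgraph homomorphism carries equidimensional KZ relations to scissors
relations, `x ∈ relations₁₂ → sub x ∈ 𝒮`.  (Moves (1a): this file; moves (2) and (1b): the next
files.) [this work, COROLLARY NF.2 (proof)] -/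
def SoloInformedDensityRemoval : Prop :=
  ∀ x ∈ soloInformedEquidimRelations, soloInformedSub x ∈ soloInformedScissorsRel

/-- **Density removal gives `KontsevichZagierPeriods → STABLE-H3`**: two volume representations with
the same volume are KZ-equivalent by the period conjecture, hence `relations₁₂`-congruent after `k`
flattenings (THEOREM NF), hence their `(k+1)`-st flattenings are scissors congruent (`sub` of the
congruence, `sub ∘ Fl^k ≡ Fl^(k+1)` on volume representations). [this work, COROLLARY NF.2] -/
theorem soloInformed_stableH3_of_densityRemoval (hD : SoloInformedDensityRemoval)
    (hKZ : KontsevichZagierPeriods) : SoloInformedStableH3 := by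
  intro n A B hA hB hv
  have hP : KZPeriodConjecture' :=
    kzPeriodConjecture'_iff_isRational.mpr (KontsevichZagierPeriods_iff.mp hKZ)
  have hEq : Equivalent A B := hP A B hv
  obtain ⟨k, hk⟩ := (soloInformed_equivalent_iff_exists_flatIter A B).mp hEq
  refine ⟨k + 1, ?_⟩
  have h1 := hD _ hk
  rw [map_sub] at h1
  have hA' := soloInformed_sub_sub_flatMap_mem (soloInformed_isVolRep_flatIter hA k)
  have hB' := soloInformed_sub_sub_flatMap_mem (soloInformed_isVolRep_flatIter hB k)
  have h2 : soloInformedFlatMap (of (soloInformedFlatIter A k)) -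
      soloInformedFlatMap (of (soloInformedFlatIter B k)) ∈ soloInformedScissorsRel := by
    have : soloInformedFlatMap (of (soloInformedFlatIter A k)) -
        soloInformedFlatMap (of (soloInformedFlatIter B k)) =
        (soloInformedSub (of (soloInformedFlatIter A k)) - soloInformedSub (of (soloInformedFlatIter B k)))
          - (soloInformedSub (of (soloInformedFlatIter A k)) -
              soloInformedFlatMap (of (soloInformedFlatIter A k)))
          + (soloInformedSub (of (soloInformedFlatIter B k)) -
              soloInformedFlatMap (of (soloInformedFlatIter B k))) := by abel
    rw [this]
    exact soloInformedScissorsRel.add_mem (soloInformedScissorsRel.sub_mem h1 hA') hB'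
  rwa [soloInformed_flatMap_of, soloInformed_flatMap_of] at h2

/-- **COROLLARY NF.2 from density removal**: `KontsevichZagierPeriods ↔ SoloInformedStableH3` — the
period conjecture is the stable generalized Hilbert third problem of the KZ calculus.
[this work, COROLLARY NF.2] -/
theorem soloInformed_summit_iff_stableH3_of_densityRemoval (hD : SoloInformedDensityRemoval) :
    KontsevichZagierPeriods ↔ SoloInformedStableH3 :=
  ⟨soloInformed_stableH3_of_densityRemoval hD, soloInformed_summit_of_stableH3⟩

/-! ### Density removal for the moves (1a): cutting the region under the graph -/

/-- **`U` of a domain-additivity triple is a scissors triple**: if `σ = σ₁ ∪ σ₂` with null overlap and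
`f = fᵢ` on `σᵢ`, then `U[σ, f] = U[σ₁, f₁] ∪ U[σ₂, f₂]` with overlap inside the null cylinder over
`σ₁ ∩ σ₂`, a cylinder over a null base, `KZ.volume_setOf_init_mem_eq_zero`).
[Kontsevich–Zagier 2001, §1.2 rule (1); this work] -/
theorem soloInformed_under_triple_mem_scissorsGen {r r₁ r₂ : IntegralRep n}
    (hdom : r.domain = r₁.domain ∪ r₂.domain) (hnull : volume (r₁.domain ∩ r₂.domain) = 0)
    (h₁ : EqOn r.integrand r₁.integrand r₁.domain) (h₂ : EqOn r.integrand r₂.integrand r₂.domain) :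
    of (soloInformedUnder r) - of (soloInformedUnder r₁) - of (soloInformedUnder r₂) ∈
      soloInformedScissorsGen := by
  refine soloInformed_mem_scissorsGen (soloInformed_isVolRep_under r) (soloInformed_isVolRep_under r₁)
    (soloInformed_isVolRep_under r₂) ?_ ?_
  · ext z
    simp only [mem_union, soloInformed_mem_under_domain, hdom]
    constructor
    · rintro ⟨hx | hx, h0, hf⟩
      · exact Or.inl ⟨hx, h0, by rwa [h₁ hx] at hf⟩
      · exact Or.inr ⟨hx, h0, by rwa [h₂ hx] at hf⟩
    · rintro (⟨hx, h0, hf⟩ | ⟨hx, h0, hf⟩)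
      · exact ⟨Or.inl hx, h0, by rwa [h₁ hx]⟩
      · exact ⟨Or.inr hx, h0, by rwa [h₂ hx]⟩
  · refine measure_mono_null (fun z hz => ?_) (KZ.volume_setOf_init_mem_eq_zero hnull)
    rw [mem_inter_iff, soloInformed_mem_under_domain, soloInformed_mem_under_domain] at hz
    exact ⟨hz.1.1, hz.2.1⟩

/-- **Density removal for the moves (1a)**: `c ∈ domainAddRel → sub c ∈ 𝒮` (both `U(·)` and
`U(·⁻)` of the triple are scissors triples). [this work, COROLLARY NF.2 (proof, case (1a))] -/
theorem soloInformed_sub_mem_scissorsRel_of_mem_domainAddRel {c : FormalRep} (hc : c ∈ domainAddRel) :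
    soloInformedSub c ∈ soloInformedScissorsRel := by
  obtain ⟨n, r, r₁, r₂, hdom, hnull, h₁, h₂, rfl⟩ := hc
  have hpos := soloInformed_scissorsGen_subset_scissorsRel
    (soloInformed_under_triple_mem_scissorsGen hdom hnull h₁ h₂)
  have hneg : of (soloInformedUnder r.neg) - of (soloInformedUnder r₁.neg) -
      of (soloInformedUnder r₂.neg) ∈ soloInformedScissorsRel := by
    refine soloInformed_scissorsGen_subset_scissorsRel
      (soloInformed_under_triple_mem_scissorsGen (r := r.neg) (r₁ := r₁.neg) (r₂ := r₂.neg)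
        hdom hnull (fun x hx => ?_) (fun x hx => ?_))
    · simp only [IntegralRep.integrand_neg, Pi.neg_apply, h₁ hx]
    · simp only [IntegralRep.integrand_neg, Pi.neg_apply, h₂ hx]
  rw [map_sub, map_sub, soloInformed_sub_of, soloInformed_sub_of, soloInformed_sub_of]
  have : of (soloInformedUnder r) - of (soloInformedUnder r.neg) -
        (of (soloInformedUnder r₁) - of (soloInformedUnder r₁.neg)) -
        (of (soloInformedUnder r₂) - of (soloInformedUnder r₂.neg)) =
      (of (soloInformedUnder r) - of (soloInformedUnder r₁) - of (soloInformedUnder r₂)) -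
        (of (soloInformedUnder r.neg) - of (soloInformedUnder r₁.neg) -
          of (soloInformedUnder r₂.neg)) := by abel
  rw [this]
  exact soloInformedScissorsRel.sub_mem hpos hneg

/-- **Cutting the base of a region under a graph is a scissors move**: for a `ℚ`-semialgebraic
decomposition `σ = P ∪ Q` with `vol (P ∩ Q) = 0`,
`[U(r)] − [U(r|P)] − [U(r|Q)] ∈ soloInformedScissorsGen`. [this work] -/
theorem soloInformed_under_restrict_mem_scissorsGen (r : IntegralRep n) {P Q : Set (Fin n → ℝ)}
    (hP : IsSemialgebraic ℚ P) (hQ : IsSemialgebraic ℚ Q) (hPσ : P ⊆ r.domain) (hQσ : Q ⊆ r.domain)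
    (hcover : r.domain = P ∪ Q) (hnull : volume (P ∩ Q) = 0) :
    of (soloInformedUnder r) - of (soloInformedUnder (r.restrict P hP hPσ)) -
      of (soloInformedUnder (r.restrict Q hQ hQσ)) ∈ soloInformedScissorsGen :=
  soloInformed_under_triple_mem_scissorsGen (r₁ := r.restrict P hP hPσ) (r₂ := r.restrict Q hQ hQσ)
    hcover hnull (fun _ _ => rfl) (fun _ _ => rfl)

/-- `sub` of a representation splits along a semialgebraic decomposition of its base with null
overlap: `sub [r] − sub [r|P] − sub [r|Q] ∈ 𝒮`. [this work] -/
theorem soloInformed_sub_restrict_mem_scissorsRel (r : IntegralRep n) {P Q : Set (Fin n → ℝ)}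
    (hP : IsSemialgebraic ℚ P) (hQ : IsSemialgebraic ℚ Q) (hPσ : P ⊆ r.domain) (hQσ : Q ⊆ r.domain)
    (hcover : r.domain = P ∪ Q) (hnull : volume (P ∩ Q) = 0) :
    soloInformedSub (of r) - soloInformedSub (of (r.restrict P hP hPσ)) -
      soloInformedSub (of (r.restrict Q hQ hQσ)) ∈ soloInformedScissorsRel := by
  have h := soloInformed_sub_mem_scissorsRel_of_mem_domainAddRel
    (c := of r - of (r.restrict P hP hPσ) - of (r.restrict Q hQ hQσ))
    ⟨n, r, r.restrict P hP hPσ, r.restrict Q hQ hQσ, hcover, hnull, fun _ _ => rfl, fun _ _ => rfl, rfl⟩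
  rwa [map_sub, map_sub] at h

/-- **Null bases carry nothing**: if `vol σ = 0` then `sub [σ, f] ∈ 𝒮` (both regions under the
graphs lie in the null cylinder over `σ`). [this work] -/
theorem soloInformed_sub_of_mem_scissorsRel_of_volume_eq_zero (r : IntegralRep n)
    (h0 : volume r.domain = 0) : soloInformedSub (of r) ∈ soloInformedScissorsRel := by
  have hU : ∀ s : IntegralRep n, volume s.domain = 0 →
      of (soloInformedUnder s) ∈ soloInformedScissorsRel := fun s hs =>
    soloInformed_of_mem_scissorsRel_of_volume_eq_zero (soloInformed_isVolRep_under s)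
      (measure_mono_null (fun z hz => ((soloInformed_mem_under_domain s z).mp hz).1)
        (KZ.volume_setOf_init_mem_eq_zero hs))
  rw [soloInformed_sub_of]
  exact soloInformedScissorsRel.sub_mem (hU r h0) (hU r.neg h0)

end Summit.KontsevichZagierPeriods.KontsevichZagierPeriods.Theorems

end
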